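/-
Copyright (c) 2026 the pub-hodgecm-mathlib formalisation cell (harness21).  Prover seat hodgecm-mathlib-B-p14 (g30), (F11) «ramified torus `(EL)¹ × E¹`» — the
STUB-FRAME ADAPTER of `stub_countIrredClause` (architect A-p06 (g26) 04:20Z ∕ 04:40Z ∕ 04:46Z; LEAD F0P3a-plan (g9) T8-41 ∕ T8-45), 2026-09-01.
-/
import Literature.NumberTheory.Rogawski1990.UnitFundamentalLemmaInertIrredClauseOfValues            -- ★ p840832∕p840904 (this seat): the clause from the three values (+ `hirr` bridge)
import Literature.NumberTheory.Rogawski1990.UnitFundamentalLemmaInertResiduallyRegularExplicit       -- ★ (A-p06): the non-split transport `ψ : U(H′)(L⁺_v) ≃ U(Φ₃)(L⁺_v)` idiom (integral match)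
import Literature.NumberTheory.Automorphic.LocalRegularOrbitClosed                                   -- ★ `map_conjLocal_transpose_localForm`, `isUnit_det_localForm`
import HarnessLib

/-!
# `stub_countIrredClause` IN ITS OWN FRAME, modulo the three values — the STUB-FRAME ADAPTER (Flicker 1998 Thm. 18; Rogawski 1990 Prop. 4.9.1 (b))

Topic `NumberTheory/Rogawski1990`; namespace `Literature.NumberTheory.Rogawski1990`.  THEOREMS ONLY (no definition, no instance, no notation, no named fact,
no `sorry`).  Cell `pub/hodgecm-mathlib`, crux H413 = `stmt-HodgeConjecture-24833`, line «N7nsCount» (tree `Cruxes/H413/Lines/F0_P3a_N7nsCount.lean`, ED. 1.2),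
MAP v3 brick (F11) (torus `(EL)¹ × E¹`).  ★ `stableOrbitalIntegralRel_eq_finsum_delta_of_not_exists_isRoot_of_values` proves the stub's equation from the three
orbital-integral VALUES `X X′ Y` and the algebra `halg`, but in the CURRENCY frame of ★ p840614 (a chosen match `b`, `hu`, the local hermitian data `hH hHd`, a
block frame `e P A hP hA`, `hΦ₂ hΦ₂d`).  THIS FILE discharges those eleven binders INSIDE, so that its head
**`stableOrbitalIntegralRel_indicator_eq_finsum_finExplicitDelta_of_not_exists_isRoot_of_values`** carries EXACTLY the binders of the registered
`stub_countIrredClause :264` (copied byte-for-byte; the ones not needed here are `_`-prefixed) PLUS ONLY `{X X′ Y} (hΦ) (hΦ′) (hΦH) (halg)`, and concludes the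
stub's statement VERBATIM (`f := 1_{K′}`, `f^H := 1_{K_H}`).  The line edition is then `stub_countIrredClause := ‹this› … (value stubs) (flicker_theorem18n_halg …)`.
DISCHARGES (all ★): the MATCH `b` with `IsLocalNormPair γ_H b` — §1 `exists_isLocalNormPair_of_nonsplit`, the transport `ψ : U(H′_v) ≃ U(Φ₃)` along an integral
hyperbolic basis (★ `exists_glInt_placeForm_eq_formCongr_antidiagonal_of_isUnramifiedIn`, ★ `localNonsplitCongr`; the proof of ★
`exists_mem_cmLocalIntegralLevel_isLocalNormPair_of_nonsplit` without its integrality half); `hu` — `χ_g` irreducible (★ `irreducible_charpoly_of_not_exists_isRoot_eval`)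
has no root, and `L_v` is a field at a non-split `v` (★ `isField_localRing_of_nonsplit`); `hH hHd` — ★ `map_conjLocal_transpose_localForm`, ★ `isUnit_det_localForm`;
the block frame — `P` := the conjugator inside `IsLocalNormPair`, `e := endoPerm`, `A := g`, `hP` from ★ `coe_endoEmbLocal` ∕ ★ `coe_endoGL`; `hA` := the `hirr`
bridge; `hΦ₂ hΦ₂d` — the same two ★ lemmas for the antidiagonal `Φ₂`.
HONEST LABEL: HC_CM is proved only modulo the printed citations until rung 0 closes; this file is bookkeeping — the VALUES are (F11-c) ∕ (F9).

## References
* [Flicker1998UnitaryFL] Y. Z. Flicker, *Elementary proof of the fundamental lemma for a unitary group*, Canad. J. Math. 50 (1998), Theorem 18 p. 97.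
* [Rogawski1990] J. D. Rogawski, *Automorphic Representations of Unitary Groups in Three Variables*, Ann. of Math. Stud. 123 (1990), §4.9 Prop. 4.9.1 (b) p. 55,
  §14.2 p. 233 («`K_v ≃ K′_v`»), §4.8 Case (a) p. 53 (the embedding `ι`).
* [Jacobowitz1962] R. Jacobowitz, *Hermitian forms over local fields*, Amer. J. Math. 84 (1962), §7.
-/

set_option autoImplicit false

noncomputable section

open MeasureTheory Measure Set Function NumberField IsDedekindDomain Matrix Polynomial
open Literature.NumberTheory.Automorphic Literature.NumberTheory.Automorphic.UnitaryGroup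
open Literature.NumberTheory.Automorphic.IntegralReduction Literature.NumberTheory.GaloisRepresentations
open Literature.NumberTheory.NumberFields Literature.NumberTheory.QuadraticForms
open scoped Matrix MatrixGroups ValuativeRel

namespace Literature.NumberTheory.Rogawski1990

variable (L : Type) [Field L] [NumberField L] [IsCMField L] (H' : Matrix (Fin 3) (Fin 3) L)
  {v : HeightOneSpectrum (𝓞 ↥(maximalRealSubfield L))}

/-! ## §1 The discharges -/

/-- `IsConj` descends along a multiplicative equivalence. [folklore] -/
private theorem isConj_of_isConj_mulEquiv' {G G' : Type*} [Monoid G] [Monoid G'] (e : G ≃* G') {a b : G}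
    (h : IsConj (e a) (e b)) : IsConj a b := by
  have h' := MonoidHom.map_isConj e.symm.toMonoidHom h
  simpa using h'

/-- **EVERY `γ_H ∈ H_v` HAS A MATCH IN `G′_v = U(H′)(L⁺_v)`** at a finite place `v` non-split and unramified in `L`, of good reduction for `H′`: `γ₀ := ψ⁻¹(ι_v γ_H)` for the
transport `ψ : U(H′)(L⁺_v) ≃ U(Φ₃)(L⁺_v)` along an integral hyperbolic basis `T` of `H′_w` (`γ₀_w = T⁻¹ ι_v(γ_H)_w T`) — the first half of ★
`exists_mem_cmLocalIntegralLevel_isLocalNormPair_of_nonsplit`, integrality dropped.  [cite: Rogawski1990, §14.2 p. 233; §4.3 p. 43] [cite: Jacobowitz1962, §7 Thm. 7.1] -/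
theorem exists_isLocalNormPair_of_nonsplit (hH' : (H'.map (IsCMField.complexConj L))ᵀ = H')
    (w : PlacesOver L v) (hw : IsCMField.complexConj L • w.1 = w.1) (hv : Algebra.IsUnramifiedIn (𝓞 L) v.asIdeal)
    (hH'w : IsUnit (placeForm H' w.1)) (hH'i : hH'w.unit ∈ glInt 3 (w.1.adicCompletion L))
    (γH : (cmDatum L 2 (Matrix.of fun i j : Fin 2 => if i.val + j.val + 1 = 2 then (1 : L) else 0)).Local v ×
      (cmDatum L 1 (Matrix.of fun i j : Fin 1 => if i.val + j.val + 1 = 1 then (1 : L) else 0)).Local v) :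
    ∃ γ₀ : (cmDatum L 3 H').Local v, IsLocalNormPair L H' v γH γ₀ := by
  have hc := IsCMField.complexConj_ne_one L
  haveI : Algebra.IsQuadraticExtension ↥(maximalRealSubfield L) L := IsCMField.isQuadraticExtension L
  obtain ⟨T, -, hJT⟩ := exists_glInt_placeForm_eq_formCongr_antidiagonal_of_isUnramifiedIn ↥(maximalRealSubfield L) L
    (IsCMField.complexConj L) hc 3 H' hH' v w hw hv hH'w hH'i
  have h : formCongr (galAdicCompletionMap (L := L) (IsCMField.complexConj L) hw) T
      (placeForm (Matrix.of fun i j : Fin 3 => if i.val + j.val + 1 = 3 then (1 : L) else 0) w.1) =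
        (1 : w.1.adicCompletion L) • placeForm H' w.1 := by
    rw [one_smul, placeForm_antidiagOne, ← hJT]
  set ψ := localNonsplitCongr (IsCMField.complexConj L) hc w hw T isUnit_one h with hψ
  set x := endoEmbLocal L v γH with hx
  have hψx : ((localNonsplitEquiv (IsCMField.complexConj L)
        (Matrix.of fun i j : Fin 3 => if i.val + j.val + 1 = 3 then (1 : L) else 0) hc w hw (ψ (ψ.symm x)) :
        unitaryGroupOfForm (galAdicCompletionMap (L := L) (IsCMField.complexConj L) hw)
          (placeForm (Matrix.of fun i j : Fin 3 => if i.val + j.val + 1 = 3 then (1 : L) else 0) w.1)) :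
        GL (Fin 3) (w.1.adicCompletion L)) =
      T * ((localNonsplitEquiv (IsCMField.complexConj L) H' hc w hw (ψ.symm x) :
        unitaryGroupOfForm (galAdicCompletionMap (L := L) (IsCMField.complexConj L) hw) (placeForm H' w.1)) :
        GL (Fin 3) (w.1.adicCompletion L)) * T⁻¹ :=
    localNonsplitEquiv_localNonsplitCongr (IsCMField.complexConj L) hc w hw T isUnit_one h (ψ.symm x)
  rw [ContinuousMulEquiv.apply_symm_apply] at hψx
  have hconj : ((localNonsplitEquiv (IsCMField.complexConj L) H' hc w hw (ψ.symm x) :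
        unitaryGroupOfForm (galAdicCompletionMap (L := L) (IsCMField.complexConj L) hw) (placeForm H' w.1)) :
        GL (Fin 3) (w.1.adicCompletion L)) =
      T⁻¹ * ((localNonsplitEquiv (IsCMField.complexConj L)
        (Matrix.of fun i j : Fin 3 => if i.val + j.val + 1 = 3 then (1 : L) else 0) hc w hw x :
        unitaryGroupOfForm (galAdicCompletionMap (L := L) (IsCMField.complexConj L) hw)
          (placeForm (Matrix.of fun i j : Fin 3 => if i.val + j.val + 1 = 3 then (1 : L) else 0) w.1)) :
        GL (Fin 3) (w.1.adicCompletion L)) * T := by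
    rw [hψx]; group
  refine ⟨ψ.symm x, ?_⟩
  show IsConj ((x.val : GL (Fin 3) (LocalRing L v))) ((ψ.symm x).val : GL (Fin 3) (LocalRing L v))
  refine isConj_of_isConj_mulEquiv'
    ((localGLPiEquiv L 3 v).toMulEquiv.trans (localGLPiEvalEquiv (IsCMField.complexConj L) 3 hc w hw).toMulEquiv) ?_
  show IsConj
    ((localNonsplitEquiv (IsCMField.complexConj L)
      (Matrix.of fun i j : Fin 3 => if i.val + j.val + 1 = 3 then (1 : L) else 0) hc w hw x :
      unitaryGroupOfForm (galAdicCompletionMap (L := L) (IsCMField.complexConj L) hw)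
        (placeForm (Matrix.of fun i j : Fin 3 => if i.val + j.val + 1 = 3 then (1 : L) else 0) w.1)) :
      GL (Fin 3) (w.1.adicCompletion L))
    ((localNonsplitEquiv (IsCMField.complexConj L) H' hc w hw (ψ.symm x) :
      unitaryGroupOfForm (galAdicCompletionMap (L := L) (IsCMField.complexConj L) hw) (placeForm H' w.1)) :
      GL (Fin 3) (w.1.adicCompletion L))
  rw [hconj]
  exact isConj_iff.2 ⟨T⁻¹, by group⟩

/-- The block frame of a match read off the embedding `ι`: if `c · ι_v(γ_H) · c⁻¹ = b` in `GL₃(L_v)` then `b · c = c · reindex e e [g 0; 0 u]` with `e = endoPerm`,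
`g` the matrix of `γ_H.1` and `u = finGammaTwo`.  [cite: Rogawski1990, §4.8 Case (a) p. 53] -/
theorem mul_eq_mul_reindex_fromBlocks_of_conj_endoEmbLocal_eq
    (γH : (cmDatum L 2 (Matrix.of fun i j : Fin 2 => if i.val + j.val + 1 = 2 then (1 : L) else 0)).Local v ×
      (cmDatum L 1 (Matrix.of fun i j : Fin 1 => if i.val + j.val + 1 = 1 then (1 : L) else 0)).Local v)
    {b : (cmDatum L 3 H').Local v} {c : GL (Fin 3) (LocalRing L v)}
    (hc : c * ((endoEmbLocal L v γH).val : GL (Fin 3) (LocalRing L v)) * c⁻¹ = (b.val : GL (Fin 3) (LocalRing L v))) :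
    (b.val.val : Matrix (Fin 3) (Fin 3) (LocalRing L v)) * c.val =
      c.val * Matrix.reindex endoPerm endoPerm (Matrix.fromBlocks ((γH.1.val : GL (Fin 2) (LocalRing L v)).val) 0 0 !![finGammaTwo L v γH]) := by
  have h1 : (b.val : GL (Fin 3) (LocalRing L v)) * c = c * ((endoEmbLocal L v γH).val : GL (Fin 3) (LocalRing L v)) := by
    rw [← hc, inv_mul_cancel_right]
  have h2 := congrArg Units.val h1
  simp only [Units.val_mul] at h2
  have h22 : ((γH.2.val : GL (Fin 1) (LocalRing L v)).val : Matrix (Fin 1) (Fin 1) (LocalRing L v)) = !![finGammaTwo L v γH] := by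
    ext i j
    fin_cases i; fin_cases j
    rfl
  rw [h2, coe_endoEmbLocal, coe_endoGL]
  dsimp only
  rw [h22]

/-- `Φ₂ = antidiag(1,1)` is `c`-hermitian. [cite: Rogawski1990, §4.8 Case (a) p. 53] -/
theorem antidiagTwo_map_transpose_cm :
    ((Matrix.of fun i j : Fin 2 => if i.val + j.val + 1 = 2 then (1 : L) else 0).map (cmConjRingHom L))ᵀ =
      Matrix.of fun i j : Fin 2 => if i.val + j.val + 1 = 2 then (1 : L) else 0 := by
  ext i j
  fin_cases i <;> fin_cases j <;> simp [Matrix.transpose_apply, Matrix.map_apply]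

omit [IsCMField L] in
/-- `det Φ₂ ≠ 0`. [cite: Rogawski1990, §4.8 Case (a) p. 53] -/
theorem det_antidiagTwo_ne_zero : (Matrix.of fun i j : Fin 2 => if i.val + j.val + 1 = 2 then (1 : L) else 0).det ≠ 0 := by
  rw [Matrix.det_fin_two]
  simp

/-! ## §2 The adapter -/

open scoped Classical in
/-- **`stub_countIrredClause` FROM THE THREE VALUES, IN THE STUB'S OWN FRAME.**  Binders = the registered stub's (tree `Cruxes/H413/Lines/F0_P3a_N7nsCount.lean`
`:264`, byte-for-byte; the ones this bookkeeping does not read are `_`-prefixed) + `{X X′ Y} (hΦ) (hΦ′) (hΦH) (halg)`; conclusion = the stub's, verbatim.  The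
line edition: `stub_countIrredClause … := ‹this› … (stub_irredGValuePos …) (stub_irredGValueNeg …) (stub_irredHValue …) (flicker_theorem18n_halg …)`.
[cite: Flicker1998UnitaryFL, Theorem 18 p. 97] [cite: Rogawski1990, §4.9 Prop. 4.9.1 (b) p. 55; §4.3 (4.3.1)–(4.3.2) p. 43] -/
theorem stableOrbitalIntegralRel_indicator_eq_finsum_finExplicitDelta_of_not_exists_isRoot_of_values
    (hH' : (H'.map (IsCMField.complexConj L))ᵀ = H') (w : PlacesOver L v)
    (hw : IsCMField.complexConj L • w.1 = w.1) (hv : Algebra.IsUnramifiedIn (𝓞 L) v.asIdeal)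
    (hH'w : IsUnit (placeForm H' w.1)) (hH'i : hH'w.unit ∈ glInt 3 (w.1.adicCompletion L))
    (μ : HeckeCharacter L) (hμ : μ.IsUnramifiedAt w.1)
    [MeasurableSpace ((cmDatum L 3 H').Local v)] [BorelSpace ((cmDatum L 3 H').Local v)]
    [∀ γ : ((cmDatum L 3 H').Local v), MeasurableSpace (((cmDatum L 3 H').Local v) ⧸ Subgroup.centralizer ({γ} : Set ((cmDatum L 3 H').Local v)))]
    [∀ γ : ((cmDatum L 3 H').Local v), BorelSpace (((cmDatum L 3 H').Local v) ⧸ Subgroup.centralizer ({γ} : Set ((cmDatum L 3 H').Local v)))]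
    [MeasurableSpace ((cmDatum L 2 (Matrix.of fun i j : Fin 2 => if i.val + j.val + 1 = 2 then (1 : L) else 0)).Local v ×
      (cmDatum L 1 (Matrix.of fun i j : Fin 1 => if i.val + j.val + 1 = 1 then (1 : L) else 0)).Local v)]
    [BorelSpace ((cmDatum L 2 (Matrix.of fun i j : Fin 2 => if i.val + j.val + 1 = 2 then (1 : L) else 0)).Local v ×
      (cmDatum L 1 (Matrix.of fun i j : Fin 1 => if i.val + j.val + 1 = 1 then (1 : L) else 0)).Local v)]
    [∀ a : ((cmDatum L 2 (Matrix.of fun i j : Fin 2 => if i.val + j.val + 1 = 2 then (1 : L) else 0)).Local v ×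
      (cmDatum L 1 (Matrix.of fun i j : Fin 1 => if i.val + j.val + 1 = 1 then (1 : L) else 0)).Local v),
      MeasurableSpace (((cmDatum L 2 (Matrix.of fun i j : Fin 2 => if i.val + j.val + 1 = 2 then (1 : L) else 0)).Local v ×
      (cmDatum L 1 (Matrix.of fun i j : Fin 1 => if i.val + j.val + 1 = 1 then (1 : L) else 0)).Local v) ⧸ Subgroup.centralizer ({a} : Set ((cmDatum L 2 (Matrix.of fun i j : Fin 2 => if i.val + j.val + 1 = 2 then (1 : L) else 0)).Local v ×
      (cmDatum L 1 (Matrix.of fun i j : Fin 1 => if i.val + j.val + 1 = 1 then (1 : L) else 0)).Local v)))]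
    [∀ a : ((cmDatum L 2 (Matrix.of fun i j : Fin 2 => if i.val + j.val + 1 = 2 then (1 : L) else 0)).Local v ×
      (cmDatum L 1 (Matrix.of fun i j : Fin 1 => if i.val + j.val + 1 = 1 then (1 : L) else 0)).Local v),
      BorelSpace (((cmDatum L 2 (Matrix.of fun i j : Fin 2 => if i.val + j.val + 1 = 2 then (1 : L) else 0)).Local v ×
      (cmDatum L 1 (Matrix.of fun i j : Fin 1 => if i.val + j.val + 1 = 1 then (1 : L) else 0)).Local v) ⧸ Subgroup.centralizer ({a} : Set ((cmDatum L 2 (Matrix.of fun i j : Fin 2 => if i.val + j.val + 1 = 2 then (1 : L) else 0)).Local v ×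
      (cmDatum L 1 (Matrix.of fun i j : Fin 1 => if i.val + j.val + 1 = 1 then (1 : L) else 0)).Local v)))]
    (νH : Measure ((cmDatum L 2 (Matrix.of fun i j : Fin 2 => if i.val + j.val + 1 = 2 then (1 : L) else 0)).Local v ×
      (cmDatum L 1 (Matrix.of fun i j : Fin 1 => if i.val + j.val + 1 = 1 then (1 : L) else 0)).Local v)) [νH.IsHaarMeasure] [νH.IsMulRightInvariant]
    (νG : Measure ((cmDatum L 3 H').Local v)) [νG.IsHaarMeasure] [νG.IsMulRightInvariant]
    {mH : OrbitalMeasureFamily ((cmDatum L 2 (Matrix.of fun i j : Fin 2 => if i.val + j.val + 1 = 2 then (1 : L) else 0)).Local v ×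
      (cmDatum L 1 (Matrix.of fun i j : Fin 1 => if i.val + j.val + 1 = 1 then (1 : L) else 0)).Local v)} {mG : OrbitalMeasureFamily ((cmDatum L 3 H').Local v)}
    (_hmH : mH.IsCanonical (IsLocalGRegular L v) νH)
    (_hmG : mG.IsCanonical (fun γ => IsRegularElt (γ.val : GL (Fin 3) (UnitaryGroup.LocalRing L v))) νG)
    (_hνH : νH ((((cmLocalIntegralLevel L 2 (Matrix.of fun i j : Fin 2 => if i.val + j.val + 1 = 2 then (1 : L) else 0) v).prod
      (cmLocalIntegralLevel L 1 (Matrix.of fun i j : Fin 1 => if i.val + j.val + 1 = 1 then (1 : L) else 0) v)) : Subgroup ((cmDatum L 2 (Matrix.of fun i j : Fin 2 => if i.val + j.val + 1 = 2 then (1 : L) else 0)).Local v ×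
      (cmDatum L 1 (Matrix.of fun i j : Fin 1 => if i.val + j.val + 1 = 1 then (1 : L) else 0)).Local v)) : Set ((cmDatum L 2 (Matrix.of fun i j : Fin 2 => if i.val + j.val + 1 = 2 then (1 : L) else 0)).Local v ×
      (cmDatum L 1 (Matrix.of fun i j : Fin 1 => if i.val + j.val + 1 = 1 then (1 : L) else 0)).Local v)) = 1)
    (_hνG : νG (cmLocalIntegralLevel L 3 H' v : Set ((cmDatum L 3 H').Local v)) = 1)
    (hl : ∀ (v : HeightOneSpectrum (𝓞 ↥(maximalRealSubfield L)))
      (a : (cmDatum L 2 (Matrix.of fun i j : Fin 2 => if i.val + j.val + 1 = 2 then (1 : L) else 0)).Local v ×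
      (cmDatum L 1 (Matrix.of fun i j : Fin 1 => if i.val + j.val + 1 = 1 then (1 : L) else 0)).Local v)
      (b : (cmDatum L 3 H').Local v)
      (x : (cmDatum L 2 (Matrix.of fun i j : Fin 2 => if i.val + j.val + 1 = 2 then (1 : L) else 0)).Local v ×
      (cmDatum L 1 (Matrix.of fun i j : Fin 1 => if i.val + j.val + 1 = 1 then (1 : L) else 0)).Local v),
      finExplicitDelta L v H' (x * a * x⁻¹) μ b = finExplicitDelta L v H' a μ b)
    (hr : ∀ (v : HeightOneSpectrum (𝓞 ↥(maximalRealSubfield L)))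
      (a : (cmDatum L 2 (Matrix.of fun i j : Fin 2 => if i.val + j.val + 1 = 2 then (1 : L) else 0)).Local v ×
      (cmDatum L 1 (Matrix.of fun i j : Fin 1 => if i.val + j.val + 1 = 1 then (1 : L) else 0)).Local v)
      (b y : (cmDatum L 3 H').Local v),
      finExplicitDelta L v H' a μ (y * b * y⁻¹) = finExplicitDelta L v H' a μ b)
    (hH'u : IsUnit H') (_hμu : μ.IsUnitary)
    (hμω : ∀ x : ideleGroup ↥(maximalRealSubfield L), μ (AdeleRing.ideleBaseChange ↥(maximalRealSubfield L) L x) = quadraticHeckeCharCM L x)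
    (_h2 : IsUnit (2 : 𝒪[w.1.adicCompletion L]))
    {γH : ((cmDatum L 2 (Matrix.of fun i j : Fin 2 => if i.val + j.val + 1 = 2 then (1 : L) else 0)).Local v ×
      (cmDatum L 1 (Matrix.of fun i j : Fin 1 => if i.val + j.val + 1 = 1 then (1 : L) else 0)).Local v)}
    (_hreg : IsLocalGRegular L v γH)
    (_hint : ∀ i : ℕ, ((((endoEmbLocal L v γH).val : GL (Fin 3) (LocalRing L v)).val.map
        (Pi.evalRingHom (fun w' : PlacesOver L v => w'.1.adicCompletion L) w)).charpoly.coeff i) ∈ 𝒪[w.1.adicCompletion L])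
    (_hP1 : ¬ ∃ γH₀ : ((cmDatum L 2 (Matrix.of fun i j : Fin 2 => if i.val + j.val + 1 = 2 then (1 : L) else 0)).Local v ×
      (cmDatum L 1 (Matrix.of fun i j : Fin 1 => if i.val + j.val + 1 = 1 then (1 : L) else 0)).Local v),
        γH₀ ∈ ((cmLocalIntegralLevel L 2 (Matrix.of fun i j : Fin 2 => if i.val + j.val + 1 = 2 then (1 : L) else 0) v).prod
      (cmLocalIntegralLevel L 1 (Matrix.of fun i j : Fin 1 => if i.val + j.val + 1 = 1 then (1 : L) else 0) v)) ∧ IsLocalGRegular L v γH₀ ∧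
        (redMat (((endoEmbLocal L v γH₀).val : GL (Fin 3) (LocalRing L v)).val.map
          (Pi.evalRingHom (fun w' : PlacesOver L v => w'.1.adicCompletion L) w))).charpoly.Separable ∧
        IsLocalStablyConjH L v γH₀ γH)
    (_hell : ¬ ∃ (y : ((cmDatum L 2 (Matrix.of fun i j : Fin 2 => if i.val + j.val + 1 = 2 then (1 : L) else 0)).Local v ×
      (cmDatum L 1 (Matrix.of fun i j : Fin 1 => if i.val + j.val + 1 = 1 then (1 : L) else 0)).Local v)) (d' : Fin 2 → (UnitaryGroup.LocalRing L v)ˣ),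
        glDiagonal 2 (UnitaryGroup.LocalRing L v) d' = ((y * γH * y⁻¹).1.val : GL (Fin 2) (UnitaryGroup.LocalRing L v)))
    (hirr : ¬ ∃ x : w.1.adicCompletion L, (((γH.1.val : GL (Fin 2) (LocalRing L v)).val.map
        (Pi.evalRingHom (fun w' : PlacesOver L v => w'.1.adicCompletion L) w)).charpoly).IsRoot x)
    {X X' Y : ℂ}
    (hΦ : ∀ δ : (cmDatum L 3 H').Local v, IsLocalNormPair L H' v γH δ → finKappaAt L v H' γH δ = 1 →
      classOrbitalIntegral mG ((cmLocalIntegralLevel L 3 H' v : Set ((cmDatum L 3 H').Local v)).indicator fun _ => (1 : ℂ)) (ConjClasses.mk δ) = X)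
    (hΦ' : ∀ δ : (cmDatum L 3 H').Local v, IsLocalNormPair L H' v γH δ → finKappaAt L v H' γH δ = -1 →
      classOrbitalIntegral mG ((cmLocalIntegralLevel L 3 H' v : Set ((cmDatum L 3 H').Local v)).indicator fun _ => (1 : ℂ)) (ConjClasses.mk δ) = X')
    (hΦH : classOrbitalIntegral mH
        (((((cmLocalIntegralLevel L 2 (Matrix.of fun i j : Fin 2 => if i.val + j.val + 1 = 2 then (1 : L) else 0) v).prod
      (cmLocalIntegralLevel L 1 (Matrix.of fun i j : Fin 1 => if i.val + j.val + 1 = 1 then (1 : L) else 0) v)) : Subgroup ((cmDatum L 2 (Matrix.of fun i j : Fin 2 => if i.val + j.val + 1 = 2 then (1 : L) else 0)).Local v ×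
      (cmDatum L 1 (Matrix.of fun i j : Fin 1 => if i.val + j.val + 1 = 1 then (1 : L) else 0)).Local v)) : Set ((cmDatum L 2 (Matrix.of fun i j : Fin 2 => if i.val + j.val + 1 = 2 then (1 : L) else 0)).Local v ×
      (cmDatum L 1 (Matrix.of fun i j : Fin 1 => if i.val + j.val + 1 = 1 then (1 : L) else 0)).Local v)).indicator fun _ => (1 : ℂ)) (ConjClasses.mk γH) = Y)
    (halg : (-(Ideal.absNorm v.asIdeal : ℂ)) ^ WithZero.log (Valued.v (((finCharpolyTwo L v γH).eval (finGammaTwo L v γH)) w)) * (X - X') = Y) :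
    stableOrbitalIntegralRel (IsLocalStablyConjH L v) mH
        (((((cmLocalIntegralLevel L 2 (Matrix.of fun i j : Fin 2 => if i.val + j.val + 1 = 2 then (1 : L) else 0) v).prod
      (cmLocalIntegralLevel L 1 (Matrix.of fun i j : Fin 1 => if i.val + j.val + 1 = 1 then (1 : L) else 0) v)) : Subgroup ((cmDatum L 2 (Matrix.of fun i j : Fin 2 => if i.val + j.val + 1 = 2 then (1 : L) else 0)).Local v ×
      (cmDatum L 1 (Matrix.of fun i j : Fin 1 => if i.val + j.val + 1 = 1 then (1 : L) else 0)).Local v)) : Set ((cmDatum L 2 (Matrix.of fun i j : Fin 2 => if i.val + j.val + 1 = 2 then (1 : L) else 0)).Local v ×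
      (cmDatum L 1 (Matrix.of fun i j : Fin 1 => if i.val + j.val + 1 = 1 then (1 : L) else 0)).Local v)).indicator fun _ => (1 : ℂ)) γH =
      ∑ᶠ c : ConjClasses ((cmDatum L 3 H').Local v), (finExplicitCollection L H' μ hl hr v).Δ γH (Quotient.out c) *
        classOrbitalIntegral mG ((cmLocalIntegralLevel L 3 H' v : Set ((cmDatum L 3 H').Local v)).indicator fun _ => (1 : ℂ)) c := by
  classical
  -- (1) a match `b`
  obtain ⟨b, h⟩ := exists_isLocalNormPair_of_nonsplit L H' hH' w hw hv hH'w hH'i γH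
  -- (2) `χ_g` irreducible over `L_v`, hence `χ_g(u)` is a unit of the field `L_v`
  have hA : Irreducible ((γH.1.val : GL (Fin 2) (UnitaryGroup.LocalRing L v)).val.charpoly) :=
    irreducible_charpoly_of_not_exists_isRoot_eval L v w hw _ hirr
  obtain ⟨δ₁, hcδ, hδ⟩ : ∃ δ : L, IsCMField.complexConj L δ = -δ ∧ δ ≠ 0 := by
    obtain ⟨ζ, hζ⟩ := not_forall.1 fun h0 => IsCMField.complexConj_ne_one L (AlgEquiv.ext h0)
    refine ⟨ζ - IsCMField.complexConj L ζ, by rw [map_sub, IsCMField.complexConj_apply_apply, neg_sub], fun h0 => hζ ?_⟩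
    rw [sub_eq_zero] at h0
    exact h0.symm
  have hF := Liu2021.LemD1IndexedNonVacuityNonsplitPlace.isField_localRing_of_nonsplit L v (IsCMField.complexConj L) hcδ hδ w hw
  have hu : IsUnit ((finCharpolyTwo L v γH).eval (finGammaTwo L v γH)) := by
    have hne : (finCharpolyTwo L v γH).eval (finGammaTwo L v γH) ≠ 0 := by
      letI : Field (UnitaryGroup.LocalRing L v) := hF.toField
      exact Literature.LinearAlgebra.Matrix.eval_charpoly_ne_zero_of_irreducible hA (by simp) _
    obtain ⟨y, hy⟩ := hF.mul_inv_cancel hne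
    exact IsUnit.of_mul_eq_one _ hy
  -- (3) the local hermitian data of `H′` and of `Φ₂`
  have hH'c : (H'.map (cmConjRingHom L))ᵀ = H' := by
    have e : H'.map (cmConjRingHom L) = H'.map (IsCMField.complexConj L) := by
      ext i j; simp [Matrix.map_apply, cmConjRingHom_apply]
    rw [e]; exact hH'
  have hH := map_conjLocal_transpose_localForm L 3 H' v hH'c
  have hHd := isUnit_det_localForm L 3 H' v (Matrix.isUnit_iff_isUnit_det _ |>.1 hH'u).ne_zero
  have hΦ₂ := map_conjLocal_transpose_localForm L 2 _ v (antidiagTwo_map_transpose_cm L)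
  have hΦ₂d := isUnit_det_localForm L 2 _ v (det_antidiagTwo_ne_zero L)
  -- (4) the block frame of `b`
  obtain ⟨c, hc⟩ := isConj_iff.1 h
  have hP := mul_eq_mul_reindex_fromBlocks_of_conj_endoEmbLocal_eq L H' γH hc
  -- (5) the clause from the three values
  exact stableOrbitalIntegralRel_eq_finsum_delta_of_not_exists_isRoot_of_values L v H' γH b w hw μ hμω hv hμ hl hr h hu hH hHd endoPerm hP hA
    hΦ₂ hΦ₂d hirr mH mG _ _ hΦ hΦ' hΦH halg

end Literature.NumberTheory.Rogawski1990

end
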